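import Mathlib
import Literature.AlgebraicGeometry.Resolution.CompositeValuations
import Summits.ResolutionOfSingularities.ResolutionOfSingularities.Theorems.IndSmoothValuativeSmoothingFieldTargets
import Summits.ResolutionOfSingularities.ResolutionOfSingularities.Theorems.IndSmoothValuativeSmoothingFrobeniusDecomposition
import Summits.ResolutionOfSingularities.ResolutionOfSingularities.Theorems.IndSmoothValuativeSmoothingValuationSeparability
import Literature.AlgebraicGeometry.Resolution.SmoothFactorizationsTransport
import HarnessLib

/-!
# SpecialFibre — PT for the residue field of a coarsening
# (crux `IndSmooth.ValuativeSmoothing`, stmt-ResolutionOfSingularities-16087, line `birth`;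
# lead c1 devissage programme "discrete jumps", wave 2, stub E3
# `hasSmoothFactorizations_residueField_of_valuation`)

## What is proved

Let `k` be a perfect field of characteristic `p > 0`, `k ⊆ K` a field extension, `O ≤ O₁`
valuation rings of `K` with `k ⊆ O₁`, and `a : ι → K` a finite family of elements of `O₁`.
Write `κ = O₁ / m_{O₁}` for the residue field of the coarsening `O₁`, `ā i ∈ κ` for the residues
of the `a i`, `W̄ = O / m_{O₁} ⊆ κ` for the valuation ring of `κ` induced by `O`
(`Literature.AlgebraicGeometry.Resolution.residueValuationSubring`), and
`F = k(a) = IntermediateField.adjoin k (Set.range a) ⊆ K`.  Assume that the monomials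
`ā ^ α = ∏ i, ā i ^ α i`, `α : ι → Fin p`, have `W̄`-valuations that are pairwise distinct modulo
values of `p`-th powers (`hind`).  Then PT holds for `F → κ`
(`Literature.AlgebraicGeometry.Resolution.HasSmoothFactorizations F κ`, Stacks Tag 07F2 in the
factorisation form of Tag 07C3 (2)): every `F`-algebra map `A → κ` with `A` of finite type over
`F` factors through a smooth `F`-algebra.  Here the `F`-algebra structure on `κ` is any structure
compatible with the inclusion `F ⊆ O₁ ⊆ K` and the residue map `O₁ → κ` (the instance
hypotheses of the registered signature).

This is the special-fibre input of one slicing step of the devissage proving that valuation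
rings all of whose jumps are discrete are ind-smooth: the residue field `κ_j` of the `j`-th
coarsening is ind-smooth over `F_j = k(e_0, …, e_{j-1})`.

## Proof

Give `κ` the `k`-algebra structure `k → O₁ → κ` and put `F̄ = k(ā) ⊆ κ`.

* `F̄ = F̄ ^ p [ā]` (`exists_sum_frobenius_mul_monomial`, `k` perfect), so by Mac Lane's
  criterion in the form `formallySmooth_fractionRing_of_valuation` (this is where `hind` is
  used) every finitely generated `F̄`-subalgebra `B̄ ⊆ κ` has `Frac B̄` formally smooth over `F̄`;
* hence PT holds for `F̄ → κ` (`hasSmoothFactorizations_field_of_formallySmooth`, the separable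
  case of Stacks Tag 07BV);
* the structure map `ψ : F → κ` is a `k`-algebra map sending `a i ↦ ā i`; it is injective (`F`
  is a field) with range `ψ(F) = ψ(k(a)) = k(ψ a) = k(ā) = F̄`
  (`fieldRange_adjoin_eq_adjoin_range`: `IntermediateField.adjoin_map` together with
  `k(a) = ⊤` inside `F`, via `IntermediateField.lift_adjoin` / `lift_top`), so `ψ` induces a
  ring isomorphism `e : F ≃ F̄` over `κ`, and PT is transported along `e`
  (`Literature.AlgebraicGeometry.Resolution.HasSmoothFactorizations.of_ringEquiv_base`).

## Design notes

The `k`-algebra structure on `κ` is introduced locally (`letI`) as the composite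
`IsLocalRing.residue O₁ ∘ (algebraMap k K).codRestrict O₁ hk`; its compatibility with the given
`F`-algebra structure (`ψ ∘ (k → F) = (k → κ)`) follows from the two scalar towers
`F → O₁ → K` and `F → O₁ → κ` of the signature, which force `algebraMap F O₁` to be the
inclusion (`algebraMap_residueField_eq_residue`).  The range computation is isolated in the
instance-light lemma `fieldRange_adjoin_eq_adjoin_range`, valid for any `k`-algebra map out of
`k(a)`.
-/

-- single-problem summit: the doubled namespace component is forced
set_option linter.dupNamespace false

open scoped TensorProduct

namespace Summit.ResolutionOfSingularities.ResolutionOfSingularities.Theorems.ValuativeSmoothing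

open Literature.AlgebraicGeometry.Resolution

/-- Inside `F = k(a)`, the generators `a i` (viewed as elements of `F`) generate the top
intermediate field: `k(a) = ⊤` in `IntermediateField k F`. [folklore] -/
theorem adjoin_range_mk_eq_top {k E : Type*} [Field k] [Field E] [Algebra k E] {ι : Type*}
    (a : ι → E) :
    IntermediateField.adjoin k (Set.range fun i =>
      (⟨a i, IntermediateField.subset_adjoin k _ ⟨i, rfl⟩⟩ :
        IntermediateField.adjoin k (Set.range a))) = ⊤ := by
  refine IntermediateField.lift_injective _ ?_
  rw [IntermediateField.lift_adjoin, IntermediateField.lift_top, ← Set.range_comp]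
  rfl

/-- The range of a `k`-algebra map `ψ : k(a) → L` out of a finitely (or arbitrarily) generated
subextension `k(a) ⊆ E` is the subextension of `L` generated by the images of the generators:
`ψ(k(a)) = k(ψ a)`. [folklore] -/
theorem fieldRange_adjoin_eq_adjoin_range {k E L : Type*} [Field k] [Field E] [Field L]
    [Algebra k E] [Algebra k L] {ι : Type*} (a : ι → E)
    (ψ : IntermediateField.adjoin k (Set.range a) →ₐ[k] L) :
    ψ.fieldRange = IntermediateField.adjoin k
      (Set.range fun i => ψ ⟨a i, IntermediateField.subset_adjoin k _ ⟨i, rfl⟩⟩) := by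
  rw [AlgHom.fieldRange_eq_map, ← adjoin_range_mk_eq_top a, IntermediateField.adjoin_map,
    ← Set.range_comp]
  rfl

/-- In the setting of the stub: the scalar tower `F → O₁ → K` forces the structure map
`F → O₁` to be the inclusion, i.e. `(algebraMap F O₁ y : K) = y`. [folklore] -/
theorem coe_algebraMap_valuationSubring_eq {k K : Type*} [Field k] [Field K] [Algebra k K]
    (F : IntermediateField k K) (O₁ : ValuationSubring K) [Algebra F O₁] [IsScalarTower F O₁ K]
    (y : F) : (algebraMap F O₁ y : K) = y :=
  (IsScalarTower.algebraMap_apply F O₁ K y).symm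

/-- In the setting of the stub: elements of `F` lie in `O₁`. [folklore] -/
theorem coe_mem_valuationSubring_of_isScalarTower {k K : Type*} [Field k] [Field K]
    [Algebra k K] (F : IntermediateField k K) (O₁ : ValuationSubring K) [Algebra F O₁]
    [IsScalarTower F O₁ K] (y : F) : (y : K) ∈ O₁ :=
  coe_algebraMap_valuationSubring_eq F O₁ y ▸ (algebraMap F O₁ y).2

/-- In the setting of the stub: the two scalar towers `F → O₁ → K` and `F → O₁ → κ` force the
structure map `F → κ = O₁ / m_{O₁}` to be "restrict to `O₁`, then take the residue". [folklore] -/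
theorem algebraMap_residueField_eq_residue {k K : Type*} [Field k] [Field K] [Algebra k K]
    (F : IntermediateField k K) (O₁ : ValuationSubring K) [Algebra F O₁] [IsScalarTower F O₁ K]
    [Algebra F (IsLocalRing.ResidueField O₁)]
    [IsScalarTower F O₁ (IsLocalRing.ResidueField O₁)] (y : F) :
    algebraMap F (IsLocalRing.ResidueField O₁) y =
      IsLocalRing.residue O₁ ⟨y, coe_mem_valuationSubring_of_isScalarTower F O₁ y⟩ := by
  rw [IsScalarTower.algebraMap_apply F O₁ (IsLocalRing.ResidueField O₁),
    IsLocalRing.ResidueField.algebraMap_eq]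
  congr 1
  exact Subtype.ext (coe_algebraMap_valuationSubring_eq F O₁ y)

/-- Stub E3: PT for the special fibre — the residue field of a coarsening is ind-smooth over
the subfield generated by the finer chain generators. -/
theorem hasSmoothFactorizations_residueField_of_valuation (p : ℕ) [Fact p.Prime] (k K : Type)
    [Field k] [CharP k p] [PerfectField k] [Field K] [Algebra k K]
    (O O₁ : ValuationSubring K) (hle : O ≤ O₁) (hk : ∀ c : k, algebraMap k K c ∈ O₁)
    {ι : Type} [Fintype ι] [DecidableEq ι] (a : ι → K) (ha : ∀ i, a i ∈ O₁)
    (hind : ∀ α β : ι → Fin p, α ≠ β → ∀ h : IsLocalRing.ResidueField O₁,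
      (Literature.AlgebraicGeometry.Resolution.residueValuationSubring O O₁ hle).valuation
          (∏ i, IsLocalRing.residue O₁ ⟨a i, ha i⟩ ^ (α i : ℕ)) ≠
        (Literature.AlgebraicGeometry.Resolution.residueValuationSubring O O₁ hle).valuation
          (h ^ p * ∏ i, IsLocalRing.residue O₁ ⟨a i, ha i⟩ ^ (β i : ℕ)))
    [Algebra (IntermediateField.adjoin k (Set.range a)) O₁]
    [IsScalarTower (IntermediateField.adjoin k (Set.range a)) O₁ K]
    [Algebra (IntermediateField.adjoin k (Set.range a)) (IsLocalRing.ResidueField O₁)]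
    [IsScalarTower (IntermediateField.adjoin k (Set.range a)) O₁ (IsLocalRing.ResidueField O₁)] :
    Literature.AlgebraicGeometry.Resolution.HasSmoothFactorizations (IntermediateField.adjoin k
      (Set.range a))
      (IsLocalRing.ResidueField O₁) := by
  -- the `k`-algebra structure `k → O₁ → κ` on the residue field `κ`
  letI : Algebra k (IsLocalRing.ResidueField O₁) :=
    ((IsLocalRing.residue O₁).comp ((algebraMap k K).codRestrict O₁ hk)).toAlgebra
  -- PT for `F̄ = k(ā) → κ`: Frobenius decomposition (C1), Mac Lane (C2), field targets (B)
  have hPT : HasSmoothFactorizations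
      (IntermediateField.adjoin k (Set.range fun i => IsLocalRing.residue O₁ ⟨a i, ha i⟩))
      (IsLocalRing.ResidueField O₁) :=
    hasSmoothFactorizations_field_of_formallySmooth _ _ fun B hB =>
      formallySmooth_fractionRing_of_valuation p k (IsLocalRing.ResidueField O₁)
        (fun i => IsLocalRing.residue O₁ ⟨a i, ha i⟩) (residueValuationSubring O O₁ hle) hind
        (fun x hx => exists_sum_frobenius_mul_monomial p k (IsLocalRing.ResidueField O₁) _ x hx)
        B hB
  -- the structure map `ψ : F → κ` is a `k`-algebra map with `ψ (a i) = ā i`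
  let ψ : IntermediateField.adjoin k (Set.range a) →ₐ[k] IsLocalRing.ResidueField O₁ :=
    ⟨algebraMap _ _, fun c => by
      change algebraMap _ (IsLocalRing.ResidueField O₁) (algebraMap k _ c) =
        IsLocalRing.residue O₁ ⟨algebraMap k K c, hk c⟩
      rw [algebraMap_residueField_eq_residue]
      rfl⟩
  have hψ : ∀ y, ψ y = algebraMap _ (IsLocalRing.ResidueField O₁) y := fun _ => rfl
  have hψa : ∀ i, ψ ⟨a i, IntermediateField.subset_adjoin k _ ⟨i, rfl⟩⟩ =
      IsLocalRing.residue O₁ ⟨a i, ha i⟩ := fun i => by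
    rw [hψ, algebraMap_residueField_eq_residue]
  -- its range is `F̄`
  have hrange : ψ.fieldRange =
      IntermediateField.adjoin k (Set.range fun i => IsLocalRing.residue O₁ ⟨a i, ha i⟩) := by
    rw [fieldRange_adjoin_eq_adjoin_range a ψ]
    simp only [hψa]
  have hmem : ∀ y, ψ y ∈
      IntermediateField.adjoin k (Set.range fun i => IsLocalRing.residue O₁ ⟨a i, ha i⟩) :=
    fun y => hrange ▸ (AlgHom.mem_fieldRange.mpr ⟨y, rfl⟩)
  have hsurj : ∀ z ∈
      IntermediateField.adjoin k (Set.range fun i => IsLocalRing.residue O₁ ⟨a i, ha i⟩),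
      ∃ y, ψ y = z := fun z hz => by
    rwa [← hrange, AlgHom.mem_fieldRange] at hz
  -- so `ψ` is a ring isomorphism `e : F ≃ F̄` over `κ`; transport PT along it
  let e : IntermediateField.adjoin k (Set.range a) ≃+*
      IntermediateField.adjoin k (Set.range fun i => IsLocalRing.residue O₁ ⟨a i, ha i⟩) :=
    RingEquiv.ofBijective ((ψ : _ →+* IsLocalRing.ResidueField O₁).codRestrict _ hmem)
      ⟨RingHom.injective _, fun z => by
        obtain ⟨y, hy⟩ := hsurj z.1 z.2
        exact ⟨y, Subtype.ext hy⟩⟩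
  refine hPT.of_ringEquiv_base e.symm fun r => ?_
  obtain ⟨y, rfl⟩ := e.surjective r
  rw [e.symm_apply_apply]
  rfl

end Summit.ResolutionOfSingularities.ResolutionOfSingularities.Theorems.ValuativeSmoothing
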